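import Literature.Geometry.Lorentzian.SchwarzschildKillingCoord
import Literature.Geometry.Lorentzian.KillingChartJetRigidity
import Literature.Geometry.Lorentzian.SchwarzschildKillingAlgebra
import HarnessLib

/-!
# The Killing algebra of the Schwarzschild exterior is `ℝ ∂_{t*} ⊕ so(3)`:
# discharge of the named fact `StephaniEtAl2003_schwarzschildKillingFields`

**Theorem** (`StephaniEtAl2003_schwarzschildKillingFields_holds`). For `M > 0`, every Killing field of
the `C^∞` Schwarzschild metric `Kerr.smoothMetric M 0 r₊` on the exterior `Kerr.exterior M 0 = {‖x⃗‖ > 2M}`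
(ingoing Eddington–Finkelstein / Kerr–Schild Cartesian chart) is `α ∂_{t*} + (0, W₀ x⃗)` with a constant
`α` and a constant skew-adjoint `W₀ ∈ so(3)`. Stephani–Kramer–MacCallum–Hoenselaers–Herlt, *Exact Solutions
of Einstein's Field Equations* (2003), §15.4 (the `G₄ ⊃ G₃` of Schwarzschild) with §38.2 (the maximal group
of motions of the type D vacuum fields is a `G₂` or a `G₄`).

## Proof (flow-free, in one chart)

1. The coordinate representative `Xf` of the Killing field solves the coordinate Killing equation
   `𝓛_{Xf} G = 0`, `G = Kerr.bilin M 0`, and is tangent to the spheres `{r = const}`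
   (`SchwarzschildKillingCoord.lean`: `Schwarzschild.killingEq_coordRepr`, `Schwarzschild.sdot_eq_zero_of_killingEq`
   through the Kretschmann scalar `48 M²/r⁶`).
2. At the base point `p = (0, 4M, 0, 0)` subtract the model field `α ∂_{t*} + (0, W₀ x⃗)` with the same
   value as `Xf` (possible because `Xf(p)` is tangential); the difference `Y` solves the same equation, is
   tangential, and vanishes at `p`.
3. **Pointwise linear algebra** (`Schwarzschild.eq_rotCLM_of_jet`): the differential `A = DY_p` is `g_p`-skew
   (Killing equation at a zero), has vanishing radial row and satisfies two second-order radial constraints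
   obtained from `D²⟪y⃗, Y⃗⟫(p) = 0` and the braid/prolongation identity of the coordinate Killing equation at a
   zero (`KillingJetRigidity.two_mul_apply_fderiv_fderiv_of_apply_eq_zero`, which involves only the FIRST
   derivatives of the metric, `Schwarzschild.fderiv_bilin_pt`); these force `A` to be the infinitesimal
   rotation about the radial axis through `p`.
4. Subtract that rotation field as well: the new difference has vanishing 1-jet at `p`, so it vanishes on the
   connected exterior by one-jet rigidity of the coordinate Killing equation
   (`KillingJetRigidity.eqOn_zero_of_isPreconnected`, Grönwall along segments — no completeness of the
   Killing field and no flow is needed). Hence `Xf` is the sum of the two model fields.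

## References

* H. Stephani, D. Kramer, M. MacCallum, C. Hoenselaers, E. Herlt, *Exact Solutions of Einstein's Field
  Equations*, 2nd ed., CUP 2003, §15.4 (15.19), §38.2 (after Table 38.1). [StephaniEtAl2003]
* B. O'Neill, *Semi-Riemannian Geometry*, Academic Press 1983, Ch. 9, Prop. 9.25, Lemma 9.28. [ONeill1983]
* R. M. Wald, *General Relativity*, 1984, App. C.3. [Wald1984]
* M. Visser, *The Kerr spacetime: a brief introduction*, arXiv:0706.0622, (32)–(34). [arXiv07060622]
-/

noncomputable section

set_option maxSynthPendingDepth 3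

open Set Filter Function Metric
open scoped Topology ContDiff Manifold RealInnerProductSpace
open Literature.Geometry.Lorentzian.MetricCoord

namespace Literature.Geometry.Lorentzian

namespace Schwarzschild

variable {M : ℝ} {x : E4}

/-! ### §5 The base point `p = (0, 4M, 0, 0)` and the pointwise algebra of the 1-jet at a zero -/

/-- The base point `p = (0, 4M, 0, 0)` of the exterior (`r = 4M > 2M`). [folklore] -/
def pt (M : ℝ) : E4 := !₂[0, 4 * M, 0, 0]

/-- Components of `p`. [folklore] -/
@[simp] theorem pt_apply_zero (M : ℝ) : pt M 0 = 0 := rfl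
/-- Components of `p`. [folklore] -/
@[simp] theorem pt_apply_one (M : ℝ) : pt M 1 = 4 * M := rfl
/-- Components of `p`. [folklore] -/
@[simp] theorem pt_apply_two (M : ℝ) : pt M 2 = 0 := rfl
/-- Components of `p`. [folklore] -/
@[simp] theorem pt_apply_three (M : ℝ) : pt M 3 = 0 := rfl

/-- `‖p⃗‖ = 4M` for `M > 0`. [folklore] -/
theorem spatialNorm_pt (hM : 0 < M) : E4.spatialNorm (pt M) = 4 * M := by
  have h : E4.spatialNorm (pt M) ^ 2 = (4 * M) ^ 2 := by
    rw [E4.spatialNorm_sq]; simp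
  have h0 : 0 ≤ 4 * M := by positivity
  nlinarith [E4.spatialNorm_nonneg (pt M), sq_nonneg (E4.spatialNorm (pt M) - 4 * M),
    sq_nonneg (E4.spatialNorm (pt M) + 4 * M)]

/-- `p` lies in the Schwarzschild exterior for `M > 0`. [folklore] -/
theorem pt_mem_exterior (hM : 0 < M) : pt M ∈ Kerr.exterior M 0 := by
  rw [Kerr.mem_exterior, Kerr.radius_zero_left, spatialNorm_pt hM, Kerr.rPlus_zero_right hM.le,
    max_eq_left (by positivity)]
  linarith

/-- `p⃗ ≠ 0`. [folklore] -/
theorem spatial_pt_ne_zero (hM : 0 < M) : E4.spatial (pt M) ≠ 0 :=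
  spatial_ne_zero_of_mem (pt_mem_exterior hM)

/-- `⟪p⃗, v⃗⟫ = 4M v¹`. [folklore] -/
@[simp] theorem sdot_pt (M : ℝ) (v : E4) : sdot (pt M) v = 4 * M * v 1 := by
  rw [sdot, Kerr.inner_spatial_eq]; simp

/-- `sdot v w` in coordinates. [folklore] -/
theorem sdot_eq (v w : E4) : sdot v w = v 1 * w 1 + v 2 * w 2 + v 3 * w 3 := by
  rw [sdot, Kerr.inner_spatial_eq]

/-- `ℓ_p(V) = V⁰ + V¹`. [folklore] -/
theorem ell_pt (hM : 0 < M) (V : E4) : ell (pt M) V = V 0 + V 1 := by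
  rw [ell, sdot_pt, spatialNorm_pt hM]
  field_simp

/-- `∂_V ℓ_p(A) = (A²V² + A³V³)/(4M)`. [folklore] -/
theorem dEll_pt (hM : 0 < M) (V A : E4) : dEll (pt M) V A = (A 2 * V 2 + A 3 * V 3) / (4 * M) := by
  rw [dEll, sdot_pt, sdot_pt, spatialNorm_pt hM, sdot_eq]
  field_simp
  ring

/-- **The Schwarzschild components at `p`**: `g_p(A, B) = −A⁰B⁰ + ⟪A⃗, B⃗⟫ + ½ (A⁰ + A¹)(B⁰ + B¹)`.
[cite: arXiv07060622, (32)–(34)] -/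
theorem bilin_pt (hM : 0 < M) (A B : E4) :
    Kerr.bilin M 0 (pt M) A B =
      -(A 0 * B 0) + (A 1 * B 1 + A 2 * B 2 + A 3 * B 3) + 1 / 2 * ((A 0 + A 1) * (B 0 + B 1)) := by
  rw [bilin_zero_eq M (spatial_pt_ne_zero hM), ell_pt hM, ell_pt hM, spatialNorm_pt hM, sdot_eq]
  field_simp
  ring

/-- `g_p(A, ∂₀ + ∂₁) = 2 A¹`: the functional extracting the radial component. [folklore] -/
theorem bilin_pt_basisVector_zero_add_one (hM : 0 < M) (A : E4) :
    Kerr.bilin M 0 (pt M) A (E4.basisVector 0 + E4.basisVector 1) = 2 * A 1 := by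
  rw [bilin_pt hM]
  simp [E4.basisVector]
  ring

/-- **The first derivatives of the Schwarzschild components at `p`**:
`∂_V g_p(A, B) = (1/(8M)) (−V¹ (A⁰+A¹)(B⁰+B¹) + (A²V²+A³V³)(B⁰+B¹) + (A⁰+A¹)(B²V²+B³V³))`.
[cite: KerrSchild1965, §2] -/
theorem fderiv_bilin_pt (hM : 0 < M) (V A B : E4) :
    fderiv ℝ (Kerr.bilin M 0) (pt M) V A B =
      (-(V 1 * ((A 0 + A 1) * (B 0 + B 1))) + (A 2 * V 2 + A 3 * V 3) * (B 0 + B 1) +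
        (A 0 + A 1) * (B 2 * V 2 + B 3 * V 3)) / (8 * M) := by
  rw [fderiv_bilin_zero_spin_apply M (spatial_pt_ne_zero hM), dG, ell_pt hM, ell_pt hM,
    dEll_pt hM, dEll_pt hM, sdot_pt, spatialNorm_pt hM]
  field_simp
  ring

/-- **The pointwise linear algebra at `p` (the heart of the classification).** Let `A = DY_p` be
the differential at `p` of a solution `Y` of the coordinate Killing equation of Schwarzschild with
`Y p = 0`, and `Φ = D²Y_p`. The available constraints — `A` is `g_p`-skew (`hS`, the Killing equation
at a zero), the radial row vanishes (`hR`, first derivative of `⟪y⃗, Y⃗⟫ ≡ 0`), the braid identity for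
`Φ` (`hΦ`, `KillingJetRigidity.two_mul_apply_fderiv_fderiv_of_apply_eq_zero`) and the second
derivative of `⟪y⃗, Y⃗⟫ ≡ 0` along `(∂₀, v)` (`hQ`) — force `A` to be the infinitesimal rotation about
the radial axis through `p`: `A = (0, W ·⃗)` with `W = skewGen 0 0 ρ` (the two boosts tangent to the
sphere through `p` are excluded by `hQ`). Stephani et al. 2003, §38.2 (maximal `G₄`). [cite: StephaniEtAl2003, §38.2 (after Table 38.1)] -/
theorem eq_rotCLM_of_jet (hM : 0 < M) (A : E4 →L[ℝ] E4) (Φ : E4 → E4 → E4)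
    (hS : ∀ v w, Kerr.bilin M 0 (pt M) (A v) w + Kerr.bilin M 0 (pt M) v (A w) = 0)
    (hR : ∀ v, sdot (pt M) (A v) = 0)
    (hΦ : ∀ z u w, 2 * Kerr.bilin M 0 (pt M) (Φ z u) w =
      -((fderiv ℝ (Kerr.bilin M 0) (pt M) (A z) u w + fderiv ℝ (Kerr.bilin M 0) (pt M) z (A u) w +
            fderiv ℝ (Kerr.bilin M 0) (pt M) z u (A w)) +
          (fderiv ℝ (Kerr.bilin M 0) (pt M) (A u) z w + fderiv ℝ (Kerr.bilin M 0) (pt M) u (A z) w +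
            fderiv ℝ (Kerr.bilin M 0) (pt M) u z (A w)) -
          (fderiv ℝ (Kerr.bilin M 0) (pt M) (A w) z u + fderiv ℝ (Kerr.bilin M 0) (pt M) w (A z) u +
            fderiv ℝ (Kerr.bilin M 0) (pt M) w z (A u))))
    (hQ : ∀ v, sdot v (A (E4.basisVector 0)) + sdot (E4.basisVector 0) (A v) +
      sdot (pt M) (Φ (E4.basisVector 0) v) = 0) :
    ∃ ρ : ℝ, A = rotCLM (skewGen 0 0 ρ) := by
  have hM0 : M ≠ 0 := hM.ne'
  set a0 : E4 := A (E4.basisVector 0) with ha0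
  set a1 : E4 := A (E4.basisVector 1) with ha1
  set a2 : E4 := A (E4.basisVector 2) with ha2
  set a3 : E4 := A (E4.basisVector 3) with ha3
  -- the radial row
  have r0 : a0 1 = 0 := by have h := hR (E4.basisVector 0); rw [sdot_pt] at h; simpa [hM0] using h
  have r1 : a1 1 = 0 := by have h := hR (E4.basisVector 1); rw [sdot_pt] at h; simpa [hM0] using h
  have r2 : a2 1 = 0 := by have h := hR (E4.basisVector 2); rw [sdot_pt] at h; simpa [hM0] using h
  have r3 : a3 1 = 0 := by have h := hR (E4.basisVector 3); rw [sdot_pt] at h; simpa [hM0] using h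
  -- skewness
  have s00 := hS (E4.basisVector 0) (E4.basisVector 0)
  have s01 := hS (E4.basisVector 0) (E4.basisVector 1)
  have s02 := hS (E4.basisVector 0) (E4.basisVector 2)
  have s03 := hS (E4.basisVector 0) (E4.basisVector 3)
  have s12 := hS (E4.basisVector 1) (E4.basisVector 2)
  have s13 := hS (E4.basisVector 1) (E4.basisVector 3)
  have s22 := hS (E4.basisVector 2) (E4.basisVector 2)
  have s23 := hS (E4.basisVector 2) (E4.basisVector 3)
  have s33 := hS (E4.basisVector 3) (E4.basisVector 3)
  rw [bilin_pt hM, bilin_pt hM] at s00 s01 s02 s03 s12 s13 s22 s23 s33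
  simp only [← ha0, ← ha1, ← ha2, ← ha3] at s00 s01 s02 s03 s12 s13 s22 s23 s33
  simp [E4.basisVector] at s00 s01 s02 s03 s12 s13 s22 s23 s33
  -- the reduced form of `A` on the basis: two boost parameters `b, c` and one rotation parameter `ρ`
  set b : ℝ := a0 2 with hb
  set c : ℝ := a0 3 with hc
  set ρ : ℝ := a2 3 with hρ
  have e00 : a0 0 = 0 := by linarith
  have e10 : a1 0 = 0 := by linarith
  have e02 : a2 0 = 2 * b := by linarith
  have e03 : a3 0 = 2 * c := by linarith
  have e12 : a1 2 = -b := by linarith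
  have e13 : a1 3 = -c := by linarith
  have e22 : a2 2 = 0 := by linarith
  have e33 : a3 3 = 0 := by linarith
  have e32 : a3 2 = -ρ := by linarith
  have hA0 : a0 = !₂[0, 0, b, c] := by
    ext i; fin_cases i <;> simp [e00, r0, hb, hc]
  have hA1 : a1 = !₂[0, 0, -b, -c] := by
    ext i; fin_cases i <;> simp [e10, r1, e12, e13]
  have hA2 : a2 = !₂[2 * b, 0, 0, ρ] := by
    ext i; fin_cases i <;> simp [e02, r2, e22, hρ]
  have hA3 : a3 = !₂[2 * c, 0, -ρ, 0] := by
    ext i; fin_cases i <;> simp [e03, r3, e32, e33]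
  have hA01 : A (E4.basisVector 0 + E4.basisVector 1) = 0 := by
    rw [map_add, ← ha0, ← ha1, hA0, hA1]
    ext i; fin_cases i <;> simp
  -- the second-order constraints kill the boosts
  have hb0 : b = 0 := by
    have q := hQ (E4.basisVector 2)
    have φ := hΦ (E4.basisVector 0) (E4.basisVector 2) (E4.basisVector 0 + E4.basisVector 1)
    rw [bilin_pt_basisVector_zero_add_one hM] at φ
    rw [hA01, ← ha0, ← ha2] at φ
    simp only [fderiv_bilin_pt hM, hA0, hA2, map_zero, zero_apply,
      Kerr.fderiv_bilin_basisVector_zero M 0 (Kerr.differentiableAt_bilin M 0 ⟨pt M, pt_mem_exterior hM⟩)] at φ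
    simp [E4.basisVector] at φ
    rw [sdot_pt, sdot_eq, sdot_eq] at q
    simp only [← ha2] at q
    rw [hA0, hA2] at q
    simp [E4.basisVector] at q
    field_simp at φ
    linarith
  have hc0 : c = 0 := by
    have q := hQ (E4.basisVector 3)
    have φ := hΦ (E4.basisVector 0) (E4.basisVector 3) (E4.basisVector 0 + E4.basisVector 1)
    rw [bilin_pt_basisVector_zero_add_one hM] at φ
    rw [hA01, ← ha0, ← ha3] at φ
    simp only [fderiv_bilin_pt hM, hA0, hA3, map_zero, zero_apply,
      Kerr.fderiv_bilin_basisVector_zero M 0 (Kerr.differentiableAt_bilin M 0 ⟨pt M, pt_mem_exterior hM⟩)] at φ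
    simp [E4.basisVector] at φ
    rw [sdot_pt, sdot_eq, sdot_eq] at q
    simp only [← ha3] at q
    rw [hA0, hA3] at q
    simp [E4.basisVector] at q
    field_simp at φ
    linarith
  -- conclusion
  refine ⟨ρ, ?_⟩
  have key : ∀ v : E4, A v = rotCLM (skewGen 0 0 ρ) v := by
    intro v
    rw [Kerr.eq_sum_basisVector v, map_sum, map_sum]
    simp only [map_smul, Fin.sum_univ_four, ← ha0, ← ha1, ← ha2, ← ha3, hA0, hA1, hA2, hA3, hb0, hc0]
    ext i
    fin_cases i <;> simp [rotCLM_apply, E4.basisVector, E4.ofTimeSpace]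
  exact ContinuousLinearMap.ext key

/-- `sdot` is linear in its second argument: differences. [folklore] -/
theorem sdot_sub_right (y a b : E4) : sdot y (a - b) = sdot y a - sdot y b := by
  rw [← sdotBilin_apply, ← sdotBilin_apply, ← sdotBilin_apply, map_sub]

/-- `⟪y⃗, ∂₀⟫ = 0`. [folklore] -/
@[simp] theorem sdot_basisVector_zero (y : E4) : sdot y (E4.basisVector 0) = 0 := by
  rw [sdot_eq]; simp [E4.basisVector]

/-! ### §6 Assembly: the Killing algebra of the Schwarzschild exterior is `ℝ ∂_{t*} ⊕ so(3)` -/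

section Assembly

variable [Kerr.Facts] [(Kerr.smoothMetric M 0 (Kerr.rPlus M 0)).HasLeviCivita]

/-- **Every Killing field of the Schwarzschild exterior is `α ∂_{t*} + (0, W₀ x⃗)` with `W₀ ∈ so(3)`**
(the statement of `StephaniEtAl2003_schwarzschildKillingFields` for one mass `M > 0`). Proof: the
coordinate representative `Xf` solves the coordinate Killing equation and is tangent to the spheres
(`sdot_eq_zero_of_killingEq`); subtract the model field matching `Xf` at `p = (0, 4M, 0, 0)`; the
1-jet of the difference at `p` is a rotation about the radial axis (`eq_rotCLM_of_jet`, fed by the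
braid identity `KillingJetRigidity.two_mul_apply_fderiv_fderiv_of_apply_eq_zero`); subtract that
rotation field too and conclude by one-jet rigidity on the connected exterior
(`KillingJetRigidity.eqOn_zero_of_isPreconnected`). Stephani et al. 2003, §38.2 with §15.4.
[cite: StephaniEtAl2003, §38.2 (after Table 38.1) with §15.4 (15.19)] -/
theorem killingField_eq_model (hM : 0 < M) {X : Π y : Kerr.exterior M 0, TangentSpace 𝓘(ℝ, E4) y}
    (hX : (Kerr.smoothMetric M 0 (Kerr.rPlus M 0)).toPseudoRiemannianMetric.IsKillingField X) :
    ∃ (α : ℝ) (W₀ : E3 →L[ℝ] E3), (∀ u v : E3, ⟪W₀ u, v⟫ = -⟪u, W₀ v⟫) ∧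
      ∀ x : Kerr.exterior M 0, (X x : E4) = α • E4.basisVector 0 + E4.ofTimeSpace 0 (W₀ (E4.spatial x.1)) := by
  have hM0 : M ≠ 0 := hM.ne'
  set U : Set E4 := (Kerr.exterior M 0 : Set E4) with hU_def
  have hU : IsOpen U := (Kerr.exterior M 0).isOpen
  have hp : pt M ∈ U := pt_mem_exterior hM
  -- the metric components on `U`
  have hG2 : ContDiffOn ℝ 2 (Kerr.bilin M 0) U := fun y hy ↦
    (Kerr.contDiffAt_bilin M 0 (Kerr.radius_pos_of_mem_region hy) (n := 2)).contDiffWithinAt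
  have hsymm : ∀ y ∈ U, ∀ u w : E4, Kerr.bilin M 0 y u w = Kerr.bilin M 0 y w u :=
    fun y _ u w ↦ Kerr.bilin_symm M 0 y u w
  have hnd : ∀ y ∈ U, ∀ u : E4, (∀ w, Kerr.bilin M 0 y u w = 0) → u = 0 :=
    fun y hy u hu ↦ Kerr.bilin_nondegenerate M 0 (Kerr.radius_pos_of_mem_region hy) u hu
  have hconn : IsPreconnected U :=
    (show IsConnected U from Kerr.Facts.isConnected_region 0 (Kerr.rPlus M 0)).isPreconnected
  -- the coordinate representative: Killing equation and radial tangency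
  set Xf : E4 → E4 := coordRepr M X with hXf_def
  have hXs : ContDiffOn ℝ ∞ Xf U := contDiffOn_coordRepr hX
  have hKX : ∀ y ∈ U, ∀ v w : E4, fderiv ℝ (Kerr.bilin M 0) y (Xf y) v w +
      Kerr.bilin M 0 y (fderiv ℝ Xf y v) w + Kerr.bilin M 0 y v (fderiv ℝ Xf y w) = 0 :=
    killingEq_coordRepr hX
  have hXrad : ∀ y ∈ U, sdot y (Xf y) = 0 := fun y hy ↦ sdot_eq_zero_of_killingEq hM0 hXs hKX hy
  have hXd : ∀ y ∈ U, DifferentiableAt ℝ Xf y := fun y hy ↦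
    (hXs.differentiableOn (by simp)).differentiableAt (hU.mem_nhds hy)
  -- generic facts about a model field `α ∂₀ + (0, W x⃗)`
  have model : ∀ (α : ℝ) (W : E3 →L[ℝ] E3), (∀ u v : E3, ⟪W u, v⟫ = -⟪u, W v⟫) →
      (ContDiff ℝ ∞ fun y : E4 ↦ α • E4.basisVector 0 + rotCLM W y) ∧
      (∀ y, fderiv ℝ (fun y : E4 ↦ α • E4.basisVector 0 + rotCLM W y) y = rotCLM W) ∧
      (∀ y ∈ U, ∀ v w : E4, fderiv ℝ (Kerr.bilin M 0) y (α • E4.basisVector 0 + rotCLM W y) v w +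
        Kerr.bilin M 0 y (rotCLM W v) w + Kerr.bilin M 0 y v (rotCLM W w) = 0) ∧
      (∀ y, sdot y (α • E4.basisVector 0 + rotCLM W y) = 0) := by
    intro α W hW
    refine ⟨contDiff_const.add (rotCLM W).contDiff, fun y ↦ ?_, fun y hy v w ↦ ?_, fun y ↦ ?_⟩
    · exact ((hasFDerivAt_const _ y).add (rotCLM W).hasFDerivAt).fderiv.trans (by simp)
    · have h1 := Kerr.fderiv_bilin_basisVector_zero M 0 (Kerr.differentiableAt_bilin M 0 ⟨y, hy⟩)
      have h2 := killingEq_rotCLM M hW (spatial_ne_zero_of_mem hy) v w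
      rw [map_add, map_smul, h1, smul_zero, zero_add]
      exact h2
    · rw [← sdotBilin_apply, map_add, map_smul, sdotBilin_apply, sdotBilin_apply, sdot_basisVector_zero,
        sdot_rotCLM_self hW, smul_zero, add_zero]
  -- subtracting a model solution `K` (with constant differential `K'`) from a solution `F`
  have subtract : ∀ (K : E4 → E4) (K' : E4 →L[ℝ] E4), ContDiff ℝ ∞ K → (∀ y, fderiv ℝ K y = K') →
      (∀ y ∈ U, ∀ v w : E4, fderiv ℝ (Kerr.bilin M 0) y (K y) v w +
        Kerr.bilin M 0 y (K' v) w + Kerr.bilin M 0 y v (K' w) = 0) →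
      ∀ {F : E4 → E4}, ContDiffOn ℝ ∞ F U →
      (∀ y ∈ U, ∀ v w : E4, fderiv ℝ (Kerr.bilin M 0) y (F y) v w +
        Kerr.bilin M 0 y (fderiv ℝ F y v) w + Kerr.bilin M 0 y v (fderiv ℝ F y w) = 0) →
      (ContDiffOn ℝ ∞ (fun y ↦ F y - K y) U) ∧
      (∀ y ∈ U, fderiv ℝ (fun y ↦ F y - K y) y = fderiv ℝ F y - K') ∧
      (∀ y ∈ U, ∀ v w : E4, fderiv ℝ (Kerr.bilin M 0) y (F y - K y) v w +
        Kerr.bilin M 0 y (fderiv ℝ (fun y ↦ F y - K y) y v) w +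
        Kerr.bilin M 0 y v (fderiv ℝ (fun y ↦ F y - K y) y w) = 0) := by
    intro K K' hKs hK' hKK F hFs hKF
    have hFd : ∀ y ∈ U, DifferentiableAt ℝ F y := fun y hy ↦
      (hFs.differentiableOn (by simp)).differentiableAt (hU.mem_nhds hy)
    have hKd : ∀ y, DifferentiableAt ℝ K y := fun y ↦ hKs.differentiable (by simp) y
    have hsub : ∀ y ∈ U, fderiv ℝ (fun y ↦ F y - K y) y = fderiv ℝ F y - K' :=
      fun y hy ↦ (fderiv_sub (hFd y hy) (hKd y)).trans (by rw [hK' y])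
    refine ⟨hFs.sub hKs.contDiffOn, hsub, fun y hy v w ↦ ?_⟩
    rw [hsub y hy, map_sub]
    simp only [sub_apply, map_sub]
    linear_combination hKF y hy v w - hKK y hy v w
  -- the value at `p` and the matching model
  set Z : E4 := Xf (pt M) with hZ
  have hZ1 : Z 1 = 0 := by
    have h := hXrad (pt M) hp; rw [sdot_pt] at h; simpa [hM0] using h
  set α : ℝ := Z 0 with hα
  set W₀ : E3 →L[ℝ] E3 := skewGen (Z 2 / (4 * M)) (Z 3 / (4 * M)) 0 with hW₀
  have hW₀s : ∀ u v : E3, ⟪W₀ u, v⟫ = -⟪u, W₀ v⟫ := inner_skewGen _ _ _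
  obtain ⟨hKs, hKf, hKK, hKrad⟩ := model α W₀ hW₀s
  have hKp : α • E4.basisVector 0 + rotCLM W₀ (pt M) = Z := by
    ext i
    fin_cases i <;> simp [rotCLM_apply, hW₀, pt, E4.ofTimeSpace, E4.basisVector, hα, hZ1] <;> field_simp
  -- first difference `Y = Xf - K`
  obtain ⟨hYs, hYf, hKY⟩ := subtract _ _ hKs hKf hKK hXs hKX
  set Y : E4 → E4 := fun y ↦ Xf y - (α • E4.basisVector 0 + rotCLM W₀ y) with hY
  have hY0 : Y (pt M) = 0 := by simp only [hY, hKp, hZ, sub_self]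
  have hYrad : ∀ y ∈ U, sdot y (Y y) = 0 := fun y hy ↦ by
    simp only [hY, sdot_sub_right, hXrad y hy, hKrad y, sub_zero]
  have h2le : (2 : ℕ∞ω) ≤ ∞ := ENat.LEInfty.out
  have hY2 : ContDiffOn ℝ 2 Y U := hYs.of_le h2le
  have hYd : DifferentiableAt ℝ Y (pt M) := (hYs.differentiableOn (by simp)).differentiableAt (hU.mem_nhds hp)
  -- the jet constraints at `p`
  set A : E4 →L[ℝ] E4 := fderiv ℝ Y (pt M) with hA
  have hS : ∀ v w : E4, Kerr.bilin M 0 (pt M) (A v) w + Kerr.bilin M 0 (pt M) v (A w) = 0 := by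
    intro v w
    have h := hKY (pt M) hp v w
    have e : Xf (pt M) - (α • E4.basisVector 0 + rotCLM W₀ (pt M)) = 0 := hY0
    rw [e, map_zero] at h
    simpa using h
  have hh : (fun y ↦ sdot y (Y y)) =ᶠ[𝓝 (pt M)] fun _ ↦ 0 :=
    Filter.eventually_of_mem (hU.mem_nhds hp) fun y hy ↦ hYrad y hy
  obtain ⟨hD1, hD2⟩ := fderiv_fderiv_eq_zero_of_eventuallyEq_zero hh
  have hR : ∀ v : E4, sdot (pt M) (A v) = 0 := by
    intro v
    have h := DFunLike.congr_fun hD1 v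
    rw [fderiv_sdot_apply_of_apply_eq_zero hYd hY0 v] at h
    simpa using h
  have hQ : ∀ v : E4, sdot v (A (E4.basisVector 0)) + sdot (E4.basisVector 0) (A v) +
      sdot (pt M) (fderiv ℝ (fderiv ℝ Y) (pt M) (E4.basisVector 0) v) = 0 := by
    intro v
    have h := DFunLike.congr_fun (DFunLike.congr_fun hD2 (E4.basisVector 0)) v
    rw [fderiv_fderiv_sdot_apply hU hp hY2 (E4.basisVector 0) v] at h
    simp only [zero_apply] at h
    linarith
  have hΦ := fun z u w ↦
    KillingJetRigidity.two_mul_apply_fderiv_fderiv_of_apply_eq_zero hU hG2 hY2 hsymm hKY hp hY0 z u w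
  obtain ⟨ρ, hAρ⟩ := eq_rotCLM_of_jet hM A (fun z u ↦ fderiv ℝ (fderiv ℝ Y) (pt M) z u) hS hR hΦ hQ
  -- second difference `Y₂ = Y - (0, W₁ x⃗)`, `W₁` the rotation about the radial axis
  have hW₁s : ∀ u v : E3, ⟪skewGen 0 0 ρ u, v⟫ = -⟪u, skewGen 0 0 ρ v⟫ := inner_skewGen _ _ _
  obtain ⟨hK₁s, hK₁f, hKK₁, -⟩ := model 0 (skewGen 0 0 ρ) hW₁s
  obtain ⟨hY₂s, hY₂f, hKY₂⟩ := subtract _ _ hK₁s hK₁f hKK₁ hYs hKY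
  have hY₂0 : Y (pt M) - ((0 : ℝ) • E4.basisVector 0 + rotCLM (skewGen 0 0 ρ) (pt M)) = 0 := by
    rw [hY0]
    ext i
    fin_cases i <;> simp [rotCLM_apply, pt, E4.ofTimeSpace, E4.basisVector]
  have hY₂1 : fderiv ℝ (fun y ↦ Y y - ((0 : ℝ) • E4.basisVector 0 + rotCLM (skewGen 0 0 ρ) y)) (pt M) = 0 := by
    rw [hY₂f (pt M) hp, ← hA, hAρ, sub_self]
  have hzero := KillingJetRigidity.eqOn_zero_of_isPreconnected hU hconn hG2 (hY₂s.of_le h2le)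
    hsymm hnd hKY₂ hp hY₂0 hY₂1
  -- conclusion
  refine ⟨α, W₀ + skewGen 0 0 ρ, fun u v ↦ ?_, fun x ↦ ?_⟩
  · simp only [add_apply, inner_add_left, inner_add_right, hW₀s u v, hW₁s u v]
    ring
  · have h := (hzero x x.2).1
    have hlin : ∀ a b : E3, E4.ofTimeSpace 0 (a + b) = E4.ofTimeSpace 0 a + E4.ofTimeSpace 0 b :=
      fun a b ↦ by rw [← E4.spaceEmbed_apply, map_add]; rfl
    have hx : Xf x = α • E4.basisVector 0 + rotCLM W₀ x + rotCLM (skewGen 0 0 ρ) x := by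
      simp only [hY, zero_smul, zero_add, sub_eq_zero] at h
      rw [sub_eq_iff_eq_add.1 h]
      abel
    have hfin : α • E4.basisVector 0 + rotCLM W₀ x + rotCLM (skewGen 0 0 ρ) x =
        α • E4.basisVector 0 + E4.ofTimeSpace 0 ((W₀ + skewGen 0 0 ρ) (E4.spatial x.1)) := by
      rw [add_apply, hlin, rotCLM_apply, rotCLM_apply]
      abel
    exact (coordRepr_eq X x).trans (hx.trans hfin)

end Assembly

end Schwarzschild

/-- **Discharge of the named fact `StephaniEtAl2003_schwarzschildKillingFields`** (Stephani–Kramer–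
MacCallum–Hoenselaers–Herlt 2003, §38.2 with §15.4: the Killing algebra of the Schwarzschild exterior
is `ℝ ∂_t ⊕ so(3)`): every Killing field of `Kerr.smoothMetric M 0 r₊` on `Kerr.exterior M 0`, `M > 0`,
is `α ∂_{t*} + (0, W₀ x⃗)` with `W₀` skew. [cite: StephaniEtAl2003, §38.2 (after Table 38.1) with §15.4 (15.19)] -/
theorem StephaniEtAl2003_schwarzschildKillingFields_holds : StephaniEtAl2003_schwarzschildKillingFields := by
  intro _ M _ hM X hX
  exact Schwarzschild.killingField_eq_model hM hX

end Literature.Geometry.Lorentzian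

end
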